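import Literature.IUT.HodgeArakelov.TwoSectionsRigidityDifference
import Literature.IUT.HodgeArakelov.FlSymmetryGenuineTower
import HarnessLib

/-!
# [IUTchII] Rmk. 1.1.1: `Rmk111_structures` AT THE GENUINE FRAME, the sign-convention theorem of (iii), the closedness
# adjective of (ii), and the `Δ_Y(M)`-triviality of the conjugation action of (iv) — proof-only sequel of
# `TwoSectionsRigidityDifference.lean`

Mochizuki, *Inter-universal Teichmüller theory II*, §1, Remark 1.1.1 (ii)–(iv), kurims manuscript (Dec. 2020) pp. 22–24
[claim: Mochizuki2012, status: disputed] (IUTchII §1 Rmk 1.1.1, kurims pp.22-24); [EtTh] Cor. 2.19 (i) p. 58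
[cite: MochizukiEtTh2009, Cor 2.19(i) p.64]. abc-iut cell, layer L6, seat abc-iut-w4-d043 (gen 6), by-name row
«IUTchII-§1-REMARKS-COVERAGE» (L6-lead gen 4; fold 13:11:10Z: Rmk1.1.1(iii) flips on the landing of
`TwoSectionsRigidityDifference`, Rmk1.1.1(iv) on the `Δ_Y`-triviality lemma + GAP row (iv)-C). PROOF-ONLY (0 `def`):
* `Reconstruction.isClosed_restrictTo` — (ii) «a CLOSED subgroup `Π_M|_H ⊆ Π_M`»: closedness of the inverse image of a closed
  `H ⊆ Π_Y(M)` (continuity of `projY`; the adjective abc-iut-L6-t1's `restrictTo` leaves implicit).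
* `rigidity_is_difference_iff_forall_mul_self_eq_one` — ABSTRACT over abc-iut-L6-t1's interface: two Def. 1.1 (ii) data that
  differ by inversion of `Π_μ(M)` cannot both be «the difference of the two sections» unless `Π_μ(M)` is `2`-torsion
  (abc-iut-w5-d225's convention record p441478 / abc-iut-w4-d019's «needs (thetaMod g)² = 1», as a theorem).
* `ModelFrame.env_commutator_eq_algSection_of_mem_ker` + `ModelFrame.conj_envAtTheta_mk_eq_of_mem_deltaY` — (iv) p. 23
  l. 11–12 «the natural conjugation action of `Π_Y(M)` on `Π_M|_{(l·Δ_Θ)(M)}` factors through the natural surjection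
  `Π_Y(M) ↠ G(M)`», GENUINE at the [EtTh] model frame: conjugation by any `m ∈ Π_M` whose image in `Π_Y(M)` lies in
  `Δ_Y(M)` acts TRIVIALLY on the subquotient `Π_M|_{(l·Δ_Θ)(M)}` (cyclotomic character trivial on `Δ`, abc-iut-w5-d219's
  p420767 computation, and abc-iut-L2-t8's THEOREM `dtpYTheta_comm`: `(Δ^tp_Y)^Θ` abelian under `IsEtThOrigin`). The
  remaining content of (iv) — the `Π_C(M)`-action IS the cyclotomic character / the commutator map is `Π_C`-equivariant /
  the sections are `Π_C`-stable — is GAP row (iv)-C (the typed `FlSymmetry.act` is not pinned to conjugation).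
* `ModelFrame.exists_rmk111_structures_of_coreTower` / `exists_rmk111_structures_genuine` /
  `exists_def11Output_rmk111_structures_genuine` — `Rmk111_structures (F.reconstruction e) C′` for the
  difference-convention datum `C′` of `TwoSectionsRigidityDifference` (pinned: `C′.iso = (B8 iso)⁻¹` pointwise), at every
  core tower with the two `𝔽_l^{⋊±}` clauses resp. at abc-iut-w4-d019's GENUINE tower (p442142: binders `cl`, `hO`, `hYcl`,
  `hR1c`, `hlS`), together with the convention theorem instantiated: `rigidity_is_difference Sec (F.cyclotomicRigidity e)
  ↔ ∀ m ∈ Π_μ(M), m² = 1`. `FlSymmetry` action data degenerate as labelled in p419429 (unchanged).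
BINDER CENSUS: no `Prop` fact introduced, no FACT-LIST row consumed. HONEST FRAMING: kernel facts about the cell's own
interfaces and model; print fixes no order of the «difference»; Rmk. 1.1.1 is outside the [IUTchIII] Cor. 3.12 cone; no
side taken on Cor. 3.12; typed ≠ proved; witnessed ≠ endorsed.
-/

noncomputable section

namespace Literature.IUT.HodgeArakelov

open Literature.AnabelianGeometry.EtaleTheta Literature.AnabelianGeometry.SemiGraphs
open scoped Literature.AnabelianGeometry.EtaleTheta

universe u

/-- **IUTchII:Rmk1.1.1(ii)** (kurims p. 22 l. 14–15) «any closed subgroup `H ⊆ Π_Y(M)` determines, by forming the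
inverse image via the quotient `Π_M ↠ Π_Y(M)`, a CLOSED subgroup `Π_M|_H ⊆ Π_M`»: the inverse image
`Reconstruction.restrictTo` of a closed subgroup is closed (continuity of `projY`).
[claim: Mochizuki2012, status: disputed] (IUTchII §1 Rmk 1.1.1 (ii), kurims p.22) -/
theorem Reconstruction.isClosed_restrictTo {S : ThetaSetting.{u}} {M : MonoThetaEnv S} (R : Reconstruction M)
    {H : Subgroup R.PiY} (hH : IsClosed (H : Set R.PiY)) : IsClosed (R.restrictTo H : Set M.Pi) :=
  hH.preimage R.projY_continuous

/-- **Two Def. 1.1 (ii) data that differ by inversion of `Π_μ(M)` cannot both be «the difference of the two sections»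
unless `Π_μ(M)` is `2`-torsion** (abstract, over abc-iut-L6-t1's interface): if `C′.iso = (C.iso)⁻¹` pointwise in `Π_M`
and `rigidity_is_difference Sec C′`, then `rigidity_is_difference Sec C ↔ ∀ m ∈ Π_μ(M), m² = 1`. The convention
record behind abc-iut-w5-d225's `TwoSectionsRigidityConvention.lean` (p441478), as a theorem.
[claim: Mochizuki2012, status: disputed] (IUTchII §1 Rmk 1.1.1 (iii), kurims p.23) -/
theorem rigidity_is_difference_iff_forall_mul_self_eq_one {S : ThetaSetting.{u}} {M : MonoThetaEnv S}
    {R : Reconstruction M} {T : ThetaQuotientData R} {W : CoreTower R} (Sec : TwoSections T W)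
    (C C' : CyclotomicRigidity R)
    (hpin : ∀ c, ((C'.iso c : ↥R.extCyc) : M.Pi) = ((C.iso c : ↥R.extCyc) : M.Pi)⁻¹)
    (hC' : rigidity_is_difference Sec C') :
    rigidity_is_difference Sec C ↔ ∀ m : ↥R.extCyc, m * m = 1 := by
  have htop : ∀ m : ↥R.extCyc, (m : M.Pi) ∈ T.envAtTheta.top := fun m => by
    change (m : M.Pi) ∈ R.intCyc.top.comap R.projY
    rw [Subgroup.mem_comap, (MonoidHom.mem_ker).1 m.2]
    exact one_mem _
  constructor
  · intro hC m
    obtain ⟨c, hc⟩ := C.iso.surjective m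
    obtain ⟨a, rfl⟩ := QuotientGroup.mk_surjective c
    obtain ⟨t, ht, hta⟩ := Sec.sTheta_bijOn.2.2 (Set.mem_univ a)
    obtain ⟨s, hs, hsa⟩ := Sec.sAlg_bijOn.2.2 (Set.mem_univ a)
    obtain ⟨m₁, hm₁, h₁⟩ := hC a t s ht hs hta hsa
    obtain ⟨m₂, hm₂, h₂⟩ := hC' a t s ht hs hta hsa
    obtain rfl : m₁ = m := hm₁.symm.trans hc
    have h12 : (m₂ : M.Pi) = ((m₁ : M.Pi))⁻¹ := by rw [← hm₂, hpin, hc]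
    have hcl : (QuotientGroup.mk (⟨(m₁ : M.Pi), htop m₁⟩ : ↥T.envAtTheta.top) : T.envAtTheta.carrier) =
        QuotientGroup.mk ⟨(m₂ : M.Pi), htop m₂⟩ := h₁.trans h₂.symm
    rw [QuotientGroup.eq, Subgroup.mem_subgroupOf] at hcl
    have hmem : ((m₁ : M.Pi))⁻¹ * ((m₁ : M.Pi))⁻¹ ∈ R.extCyc ⊓ T.thetaSection := by
      refine Subgroup.mem_inf.2 ⟨mul_mem (inv_mem m₁.2) (inv_mem m₁.2), ?_⟩
      have h' : ((m₁ : M.Pi))⁻¹ * (m₂ : M.Pi) ∈ T.thetaSection := hcl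
      rwa [h12] at h'
    rw [Sec.extCyc_inf_bot, Subgroup.mem_bot] at hmem
    have h6 : (m₁ : M.Pi) * (m₁ : M.Pi) = 1 := by
      rw [← inv_inv (m₁ : M.Pi), ← mul_inv_rev, hmem, inv_one]
    exact Subtype.ext h6
  · intro hsq a t s ht hs hta hsa
    obtain ⟨m₂, hm₂, h₂⟩ := hC' a t s ht hs hta hsa
    refine ⟨C.iso (QuotientGroup.mk a), rfl, ?_⟩
    have h12 : (m₂ : M.Pi) = ((C.iso (QuotientGroup.mk a) : ↥R.extCyc) : M.Pi) := by
      rw [← hm₂, hpin]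
      exact congrArg Subtype.val (inv_eq_of_mul_eq_one_left (hsq _))
    rw [← h₂]
    congr 1
    exact Subtype.ext h12.symm


namespace ModelFrame

section Generic

variable {S : ThetaSetting.{u}} {l : ℕ} {R : RigidData.{u} S.N l}

/-- **Commutators in `Π^tp_{Y̲̲}[μ_N] = μ_N ⋊ Π^tp_{Y̲̲}` of two elements over `Δ`** (abc-iut-w5-d219's
`env_commutator_eq_algSection` with the hypotheses weakened from `l·Δ_Θ` to `Δ = Ker(aug)`, which is all its proof uses):
the cyclotomic character is trivial on `Δ`, so the `μ_N`-components cancel and the commutator is the algebraic section of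
`[x̄, ȳ]`. [cite: MochizukiEtTh2009, Def 2.13 p.47] -/
theorem env_commutator_eq_algSection_of_mem_ker (x y : R.env) (hx : ((x.right : ↥R.PiY) : R.PiX) ∈ R.aug.ker)
    (hy : ((y.right : ↥R.PiY) : R.PiX) ∈ R.aug.ker) :
    x * y * x⁻¹ * y⁻¹ =
      CycEnvelope.algSection R.augY R.chi (x.right * y.right * x.right⁻¹ * y.right⁻¹) := by
  have e1 : (R.chi.comp R.augY) x.right = 1 := chi_augY_eq_one_of_mem_ker hx
  have e2 : (R.chi.comp R.augY) y.right = 1 := chi_augY_eq_one_of_mem_ker hy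
  have e3 : (R.chi.comp R.augY) x.right⁻¹ = 1 := by rw [map_inv, e1, inv_one]
  have e4 : (R.chi.comp R.augY) y.right⁻¹ = 1 := by rw [map_inv, e2, inv_one]
  have e5 : (R.chi.comp R.augY) (x.right * y.right) = 1 := by rw [map_mul, e1, e2, mul_one]
  have e6 : (R.chi.comp R.augY) (x.right * y.right * x.right⁻¹) = 1 := by rw [map_mul, e5, e3, mul_one]
  apply SemidirectProduct.ext
  · simp only [SemidirectProduct.mul_left, SemidirectProduct.mul_right, SemidirectProduct.inv_left,
      SemidirectProduct.inv_right, e3, e4, e5, e6, e1, MulAut.one_apply, SemidirectProduct.left_inr]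
    rw [mul_right_comm x.left y.left x.left⁻¹, mul_inv_cancel, one_mul, mul_inv_cancel]
  · simp only [SemidirectProduct.mul_right, SemidirectProduct.inv_right, SemidirectProduct.right_inr]

end Generic


variable {p : ℕ} [Fact p.Prime] {Mt : MuTwoSetting p}
  {E : Mt.toThetaSetting.EtaleThetaData} {l : ℕ} (C : E.DoubleUnderline l)
  {S : ThetaSetting.{0}} (μ : Mt.toThetaSetting.CyclotomeMod l S.N)
  (hC : Mt.toThetaSetting.Compat) (hS : Mt.toThetaSetting.Sec2Hyps)
  (h15 : ThetaSetting.Prop15iii E hC) (L : C.CuspLabels)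
  (F : ModelFrame S (C.rigidData μ hC hS h15 L)) {Menv : MonoThetaEnv S}
  (e : Menv.Pi ≃ₜ* (C.rigidData μ hC hS h15 L).env)

/-- **IUTchII:Rmk1.1.1(iv)** (kurims p. 23 l. 11–12) «the natural conjugation action of `Π_Y(M)` on `Π_M|_{(l·Δ_Θ)(M)}`
factors through the natural surjection `Π_Y(M) ↠ G(M)`» — GENUINE at the [EtTh] model frame: for the model theta-quotient
datum `T` (`T.thetaSection = e⁻¹(s^alg(thetaKer))`), every `m ∈ Π_M` whose image in `Π_Y(M)` lies in
`Δ_Y(M) = Ker(Π_Y(M) ↠ G(M))` and every `u` of the `(l·Δ_Θ)`-preimage, the conjugate `m u m⁻¹` lies in the preimage and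
has THE SAME class in `Π_M|_{(l·Δ_Θ)(M)}`: `Δ_Y(M)` acts trivially, so the action of `Π_Y(M)` (through lifts to `Π_M`,
`projY` surjective) factors through `G(M)`. Ingredients: the cyclotomic character is trivial on `Δ`
(`env_commutator_eq_algSection_of_mem_ker`), `l·Δ_Θ ⊴ Π^tp_{X̲̲}`, and `Δ_Θ` central in `(Δ^tp_X)^Θ`
(`ker_thetaToEll_central`). [claim: Mochizuki2012, status: disputed] (IUTchII §1 Rmk 1.1.1 (iv), kurims p.23) -/
theorem conj_envAtTheta_mk_eq_of_mem_deltaY (T : ThetaQuotientData (F.reconstruction e))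
    (hT : T.thetaSection = (((C.rigidData μ hC hS h15 L).thetaKer.subgroupOf (C.rigidData μ hC hS h15 L).PiY).map
        (CycEnvelope.algSection (C.rigidData μ hC hS h15 L).augY (C.rigidData μ hC hS h15 L).chi)).comap
          e.toMulEquiv.toMonoidHom)
    {m : Menv.Pi} (hm : (F.reconstruction e).projY m ∈ (F.reconstruction e).DeltaY)
    {u : Menv.Pi} (hu : u ∈ T.envAtTheta.top) :
    ∃ hmu : m * u * m⁻¹ ∈ T.envAtTheta.top,
      (QuotientGroup.mk (⟨m * u * m⁻¹, hmu⟩ : ↥T.envAtTheta.top) : T.envAtTheta.carrier) =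
        QuotientGroup.mk ⟨u, hu⟩ := by
  set R : RigidData S.N l := C.rigidData μ hC hS h15 L with hRdef
  have hprojY : ∀ m : Menv.Pi, (F.reconstruction e).projY m = (e m).right := fun m => rfl
  have htop : ∀ m : Menv.Pi, m ∈ T.envAtTheta.top ↔
      (((F.reconstruction e).projY m : ↥R.PiY) : ↥C.Huu) ∈ R.lDeltaTheta := fun m => Iff.rfl
  have hmaug : Mt.aug ((((e m).right : ↥R.PiY) : ↥C.Huu) : Mt.PiTemp) = 1 :=
    (mem_deltaY_reconstruction_iff C μ hC hS h15 L F e _).1 hm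
  have hmker : (((e m).right : ↥R.PiY) : R.PiX) ∈ R.aug.ker := by
    rw [MonoidHom.mem_ker, ← OneMemClass.coe_eq_one]; exact hmaug
  have hu' : (((e u).right : ↥R.PiY) : R.PiX) ∈ R.lDeltaTheta := (htop u).1 hu
  have huker : (((e u).right : ↥R.PiY) : R.PiX) ∈ R.aug.ker := (R.lDeltaTheta_le hu').2
  have hmu : m * u * m⁻¹ ∈ T.envAtTheta.top := by
    rw [htop, hprojY, map_mul, map_mul, map_inv, SemidirectProduct.mul_right, SemidirectProduct.mul_right,
      SemidirectProduct.inv_right, Subgroup.coe_mul, Subgroup.coe_mul, Subgroup.coe_inv]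
    exact R.lDeltaTheta_normal.conj_mem _ hu' _
  refine ⟨hmu, ?_⟩
  rw [QuotientGroup.eq, Subgroup.mem_subgroupOf]
  change (m * u * m⁻¹)⁻¹ * u ∈ T.thetaSection
  have hrw : (m * u * m⁻¹)⁻¹ * u = m * u⁻¹ * m⁻¹ * u := by group
  have huinv : ((((e u)⁻¹).right : ↥R.PiY) : R.PiX) ∈ R.aug.ker := by
    rw [SemidirectProduct.inv_right, Subgroup.coe_inv]; exact inv_mem huker
  have key := env_commutator_eq_algSection_of_mem_ker (e m) (e u)⁻¹ hmker huinv
  rw [inv_inv] at key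
  rw [hrw, hT, Subgroup.mem_comap]
  change e (m * u⁻¹ * m⁻¹ * u) ∈ _
  rw [map_mul, map_mul, map_mul, map_inv, map_inv, key]
  refine Subgroup.mem_map.2 ⟨(e m).right * ((e u)⁻¹).right * (e m).right⁻¹ * ((e u)⁻¹).right⁻¹, ?_, rfl⟩
  rw [Subgroup.mem_subgroupOf]
  change Mt.toTheta (((((e m).right * ((e u)⁻¹).right * (e m).right⁻¹ * ((e u)⁻¹).right⁻¹ : ↥R.PiY) : ↥C.Huu)) :
    Mt.PiTemp) = 1
  have hθu : Mt.toTheta ((((e u).right : ↥R.PiY) : ↥C.Huu) : Mt.PiTemp) ∈ Mt.DeltaTheta :=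
    Mt.toThetaSetting.lDeltaTheta_le l (show Mt.toTheta _ ∈ Mt.lDeltaTheta l from hu')
  have hθm : Mt.toTheta ((((e m).right : ↥R.PiY) : ↥C.Huu) : Mt.PiTemp) ∈ (Mt.aug.toMonoidHom.ker).map Mt.toTheta :=
    Subgroup.mem_map_of_mem _ (by exact hmaug)
  have hc := Mt.ker_thetaToEll_central _ (inv_mem hθu) _ hθm
  simp only [SemidirectProduct.inv_right, inv_inv, Subgroup.coe_mul, Subgroup.coe_inv, map_mul, map_inv]
  rw [← hc, mul_inv_cancel_right, inv_mul_cancel]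

/-- The same for `m ∈ Δ_M = Ker(Π_M ↠ G(M))` (Def. 1.1 (i) notation): `Δ_M` acts trivially on `Π_M|_{(l·Δ_Θ)(M)}`.
[claim: Mochizuki2012, status: disputed] (IUTchII §1 Rmk 1.1.1 (iv), kurims p.23) -/
theorem conj_envAtTheta_mk_eq_of_mem_deltaM (T : ThetaQuotientData (F.reconstruction e))
    (hT : T.thetaSection = (((C.rigidData μ hC hS h15 L).thetaKer.subgroupOf (C.rigidData μ hC hS h15 L).PiY).map
        (CycEnvelope.algSection (C.rigidData μ hC hS h15 L).augY (C.rigidData μ hC hS h15 L).chi)).comap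
          e.toMulEquiv.toMonoidHom)
    {m : Menv.Pi} (hm : m ∈ (F.reconstruction e).DeltaM) {u : Menv.Pi} (hu : u ∈ T.envAtTheta.top) :
    ∃ hmu : m * u * m⁻¹ ∈ T.envAtTheta.top,
      (QuotientGroup.mk (⟨m * u * m⁻¹, hmu⟩ : ↥T.envAtTheta.top) : T.envAtTheta.carrier) =
        QuotientGroup.mk ⟨u, hu⟩ :=
  conj_envAtTheta_mk_eq_of_mem_deltaY C μ hC hS h15 L F e T hT hm hu

/-- **The convention theorem at the model frame**: for the pinned two sections of
`exists_twoSections_rigidity_of_coreTower`, B8's own Def. 1.1 (ii) datum `F.cyclotomicRigidity e` (abc-iut-L2-t2's order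
`s^alg · (s^Θ)⁻¹`) satisfies abc-iut-L6-t1's `rigidity_is_difference` (order `s^Θ · (s^alg)⁻¹`) iff `Π_μ(M)` is
`2`-torsion — alongside the datum `C′` for which it holds on the nose.
[claim: Mochizuki2012, status: disputed] (IUTchII §1 Rmk 1.1.1 (iii), kurims p.23) -/
theorem exists_twoSections_rigidity_convention_of_coreTower (hO : Mt.toThetaSetting.IsEtThOrigin)
    (hYcl : (Mt.DtpY.map Mt.toHat.toMonoidHom).topologicalClosure ≤
      Mt.DtpY.map Mt.toHat.toMonoidHom ⊔ (⁅⁅Mt.DeltaHat, Mt.DeltaHat⁆, Mt.DeltaHat⁆).topologicalClosure)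
    {η : (C.rigidData μ hC hS h15 L).PiYdd → (C.rigidData μ hC hS h15 L).mu}
    (hη : η ∈ (C.rigidData μ hC hS h15 L).thetaCocycles)
    (W : CoreTower (F.reconstruction e))
    (hWker : W.kerEll = ((Mt.thetaToEll.comp Mt.toTheta).ker).comap
      (C.Huu.subtype.comp (Mt.GtpY.subgroupOf C.Huu).subtype)) :
    ∃ (T : ThetaQuotientData (F.reconstruction e)) (Sec : TwoSections T W)
      (C' : CyclotomicRigidity (F.reconstruction e)),
      T.thetaSection = (((C.rigidData μ hC hS h15 L).thetaKer.subgroupOf (C.rigidData μ hC hS h15 L).PiY).map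
          (CycEnvelope.algSection (C.rigidData μ hC hS h15 L).augY (C.rigidData μ hC hS h15 L).chi)).comap
          e.toMulEquiv.toMonoidHom ∧
      (∀ c, ((C'.iso c : ↥(F.reconstruction e).extCyc) : Menv.Pi) =
        (((F.cyclotomicRigidity e).iso c : ↥(F.reconstruction e).extCyc) : Menv.Pi)⁻¹) ∧
      rigidity_is_difference Sec C' ∧
      (rigidity_is_difference Sec (F.cyclotomicRigidity e) ↔ ∀ m : ↥(F.reconstruction e).extCyc, m * m = 1) := by
  obtain ⟨T, Sec, C', hT, hpin, hdiff, -, -⟩ :=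
    exists_twoSections_rigidity_of_coreTower C μ hC hS h15 L F e hO hYcl hη W hWker
  exact ⟨T, Sec, C', hT, hpin, hdiff, rigidity_is_difference_iff_forall_mul_self_eq_one Sec _ C' hpin hdiff⟩

/-- **IUTchII:Rmk1.1.1 — `Rmk111_structures` at the model frame for the difference-convention datum**, for every core
tower satisfying the two `𝔽_l^{⋊±}`-clauses of Rmk. 1.1.1 (iv) (`Δ_X(M) ⊴ Δ_C(M)`, `Δ_C(M)/Δ_X(M) ≅ 𝔽_l^{⋊±}`): the
`FlSymmetry` conjunct by abc-iut-w5-d219's `flSymmetry_nonempty_of_coreTower` (p420767; action data degenerate as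
labelled there). [claim: Mochizuki2012, status: disputed] (IUTchII §1 Rmk 1.1.1, kurims pp.21-24) -/
theorem exists_rmk111_structures_of_coreTower (hO : Mt.toThetaSetting.IsEtThOrigin)
    (hYcl : (Mt.DtpY.map Mt.toHat.toMonoidHom).topologicalClosure ≤
      Mt.DtpY.map Mt.toHat.toMonoidHom ⊔ (⁅⁅Mt.DeltaHat, Mt.DeltaHat⁆, Mt.DeltaHat⁆).topologicalClosure)
    {η : (C.rigidData μ hC hS h15 L).PiYdd → (C.rigidData μ hC hS h15 L).mu}
    (hη : η ∈ (C.rigidData μ hC hS h15 L).thetaCocycles)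
    (W : CoreTower (F.reconstruction e))
    (hWker : W.kerEll = ((Mt.thetaToEll.comp Mt.toTheta).ker).comap
      (C.Huu.subtype.comp (Mt.GtpY.subgroupOf C.Huu).subtype))
    (hN : (W.DeltaXplain.subgroupOf W.DeltaC).Normal)
    (hq : Nonempty (W.DeltaC ⧸ W.DeltaXplain.subgroupOf W.DeltaC ≃* Literature.IUT.HodgeTheaters.FlPM S.l)) :
    ∃ C' : CyclotomicRigidity (F.reconstruction e),
      (∀ c, ((C'.iso c : ↥(F.reconstruction e).extCyc) : Menv.Pi) =
        (((F.cyclotomicRigidity e).iso c : ↥(F.reconstruction e).extCyc) : Menv.Pi)⁻¹) ∧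
      Rmk111_structures (F.reconstruction e) C' := by
  obtain ⟨T, Sec, C', hT, hpin, hdiff, -, -⟩ :=
    exists_twoSections_rigidity_of_coreTower C μ hC hS h15 L F e hO hYcl hη W hWker
  exact ⟨C', hpin, T, W, Sec, hdiff, flSymmetry_nonempty_of_coreTower F e T hT W Sec hN hq⟩

/-- **IUTchII:Rmk1.1.1 — `Rmk111_structures` INHABITED AT THE GENUINE FRAME** (core tower, theta-quotient datum, two
sections ALL genuine; abc-iut-w4-d019's `exists_coreTower_flSymmetry_of_cLevelData`, p442142, supplies the tower and the
`FlSymmetry` conjunct): for the Def. 1.1 (ii) datum `C′` whose isomorphism is the difference `t · s⁻¹` of the two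
sections (pinned pointwise to the inverse of B8's), the Rmk. 1.1.1 existence predicate of abc-iut-L6-t1 holds. Binders:
`cl`, `hO`, `hYcl`, `hR1c`, `hlS : S.l = l` (p442142's) and a theta cocycle `η`.
[claim: Mochizuki2012, status: disputed] (IUTchII §1 Rmk 1.1.1, kurims pp.21-24) -/
theorem exists_rmk111_structures_genuine (cl : Mt.CLevelData) (hO : Mt.toThetaSetting.IsEtThOrigin)
    (hYcl : (Mt.DtpY.map Mt.toHat.toMonoidHom).topologicalClosure ≤
      Mt.DtpY.map Mt.toHat.toMonoidHom ⊔ (⁅⁅Mt.DeltaHat, Mt.DeltaHat⁆, Mt.DeltaHat⁆).topologicalClosure)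
    (hR1c : ∀ x : Mt.PiTemp, Mt.toZ (cl.conjX Mt.epsPM x) = (Mt.toZ x)⁻¹) (hlS : S.l = l)
    {η : (C.rigidData μ hC hS h15 L).PiYdd → (C.rigidData μ hC hS h15 L).mu}
    (hη : η ∈ (C.rigidData μ hC hS h15 L).thetaCocycles) :
    ∃ (W : CoreTower (F.reconstruction e)) (T : ThetaQuotientData (F.reconstruction e)) (Sec : TwoSections T W)
      (C' : CyclotomicRigidity (F.reconstruction e)),
      W.PiC = TopGroup.of Mt.GtpC ∧
      T.thetaSection = (((C.rigidData μ hC hS h15 L).thetaKer.subgroupOf (C.rigidData μ hC hS h15 L).PiY).map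
          (CycEnvelope.algSection (C.rigidData μ hC hS h15 L).augY (C.rigidData μ hC hS h15 L).chi)).comap
          e.toMulEquiv.toMonoidHom ∧
      (∀ c, ((C'.iso c : ↥(F.reconstruction e).extCyc) : Menv.Pi) =
        (((F.cyclotomicRigidity e).iso c : ↥(F.reconstruction e).extCyc) : Menv.Pi)⁻¹) ∧
      rigidity_is_difference Sec C' ∧ Nonempty (FlSymmetry Sec) ∧
      Rmk111_structures (F.reconstruction e) C' := by
  obtain ⟨W, h1, h2, -, -, hFl⟩ :=
    exists_coreTower_flSymmetry_of_cLevelData C μ hC hS h15 L F e cl hO hYcl hR1c hlS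
  obtain ⟨T, Sec, C', hT, hpin, hdiff, -, -⟩ :=
    exists_twoSections_rigidity_of_coreTower C μ hC hS h15 L F e hO hYcl hη W h2
  exact ⟨W, T, Sec, C', h1, hT, hpin, hdiff, hFl T hT Sec, T, W, Sec, hdiff, hFl T hT Sec⟩

/-- The same packaged as a **Def. 1.1 output**: at the genuine frame there is a `Def11Output M` whose Def. 1.1 (i)
part is B8's genuine `F.reconstruction e` and whose Def. 1.1 (ii) part satisfies `Rmk111_structures` («the Def. 1.1 (ii)
isomorphism is the difference of the two sections» holds for it ON THE NOSE).
[claim: Mochizuki2012, status: disputed] (IUTchII §1 Rmk 1.1.1 (iii), kurims p.23) -/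
theorem exists_def11Output_rmk111_structures_genuine (cl : Mt.CLevelData) (hO : Mt.toThetaSetting.IsEtThOrigin)
    (hYcl : (Mt.DtpY.map Mt.toHat.toMonoidHom).topologicalClosure ≤
      Mt.DtpY.map Mt.toHat.toMonoidHom ⊔ (⁅⁅Mt.DeltaHat, Mt.DeltaHat⁆, Mt.DeltaHat⁆).topologicalClosure)
    (hR1c : ∀ x : Mt.PiTemp, Mt.toZ (cl.conjX Mt.epsPM x) = (Mt.toZ x)⁻¹) (hlS : S.l = l)
    {η : (C.rigidData μ hC hS h15 L).PiYdd → (C.rigidData μ hC hS h15 L).mu}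
    (hη : η ∈ (C.rigidData μ hC hS h15 L).thetaCocycles) :
    ∃ O : Def11Output Menv, O.recon = F.reconstruction e ∧ Rmk111_structures O.recon O.rigidity := by
  obtain ⟨W, T, Sec, C', -, -, -, -, -, h⟩ :=
    exists_rmk111_structures_genuine C μ hC hS h15 L F e cl hO hYcl hR1c hlS hη
  exact ⟨⟨F.reconstruction e, C'⟩, rfl, h⟩

end ModelFrame

end Literature.IUT.HodgeArakelov

end
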